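import Mathlib
import Literature.NumberTheory.Automorphic.HilbertModularFormQExpansion
import Summits.Langlands.Langlands.Theorems.CapacityClassicalityHilbertIntegralOverconvergentIsCongruenceStubCoeffUnitEquivariance

/-!
# Götzky–Koecher at the cusp `∞`: glue lemmas on the Fourier-coefficient integrand

Section K of line Sketch-ideate-r1-k1 for the crux `HilbertIntegralOverconvergentIsCongruence`
(stmt-Langlands-8485): the Götzky–Koecher principle (Freitag, *Hilbert Modular Forms*, Ch. I Prop. 4.9)
for the Fourier coefficients `HilbertModular.fourierCoeffAt f ν y` of the tree's Hilbert-modular-form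
vocabulary (`Literature/NumberTheory/Automorphic/HilbertModularFormQExpansion.lean`).  This file holds the
elementary glue used by the composition (`…Koecher.lean`) of the eight registered stubs K-A1 … K-G:

* coordinates: the imaginary parts of a cube point are the heights (`koe_cubePoint_im`); integer,
  real and imaginary shifts of the cube coordinates / heights (`koe_cubePoint_add_intCast`,
  `koe_cubePoint_add_smul`, `koe_cubePoint_height_add`);
* phases: `∑_σ σ(ν) σ(a) ∈ ℤ` for `ν` in the dual lattice and `a ∈ 𝓞 F` (`koe_sum_mul_embedding_int`,
  from `∑_σ σ = Tr`; `e^{-2πi(S+n)} = e^{-2πi S}` is the landed `kF_cexp_add_int`);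
* **periodicity of the integrand** `x ↦ f(x+iy) e^{-2πi S(ν(x+iy))}` under `ℤ^ι` (`koe_integrand_periodic`);
* a positive lower bound for finitely many positive reals, and a second real embedding of a totally
  real field of degree `≥ 2` (`koe_exists_pos_le`, `koe_exists_realEmbedding_ne`).
-/

set_option linter.dupNamespace false

noncomputable section

namespace Summit.Langlands.Langlands.Theorems.HilbertIntegralOverconvergentIsCongruence

open MeasureTheory Complex NumberField
open Literature.NumberTheory.Automorphic Literature.NumberTheory.Automorphic.HilbertModular

variable {F : Type} [Field F] [NumberField F]

/-- The imaginary parts of a cube point are the heights: `Im (x + iy)_σ = y_σ`. -/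
theorem koe_cubePoint_im (x : Coord F) (y : (F →+* ℝ) → ℝ) (σ : F →+* ℝ) :
    (cubePoint x y σ).im = y σ := by
  simp [cubePoint]

/-- A cube point at positive height lies in the half space. -/
theorem koe_cubePoint_mem_halfSpace (x : Coord F) {y : (F →+* ℝ) → ℝ} (hy : ∀ σ, 0 < y σ) :
    cubePoint x y ∈ halfSpace F := fun σ ↦ by
  rw [koe_cubePoint_im]; exact hy σ

/-- `x ↦ x + iy` is continuous in the cube coordinates. -/
theorem koe_continuous_cubePoint (y : (F →+* ℝ) → ℝ) : Continuous fun x : Coord F ↦ cubePoint x y :=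
  continuous_pi fun σ ↦ by simp only [cubePoint, realPoint]; fun_prop

/-- Translating the cube coordinates by an integer vector `m` translates the cube point by the element
`∑_i m_i b_i` of `𝓞 F` (through the real embeddings). -/
theorem koe_cubePoint_add_intCast (x : Coord F) (m : Module.Free.ChooseBasisIndex ℤ (𝓞 F) → ℤ)
    (y : (F →+* ℝ) → ℝ) :
    cubePoint (x + fun i ↦ (m i : ℝ)) y =
      fun σ ↦ cubePoint x y σ + ((σ ((∑ i, m i • RingOfIntegers.basis F i : 𝓞 F) : F) : ℝ) : ℂ) := by
  funext σ
  have hsum : (σ ((∑ i, m i • RingOfIntegers.basis F i : 𝓞 F) : F) : ℝ) =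
      ∑ i, (m i : ℝ) * σ (integralBasis F i) := by
    simp only [integralBasis_apply]
    push_cast
    simp [map_sum, zsmul_eq_mul]
  simp only [cubePoint, realPoint, Pi.add_apply, add_mul, Finset.sum_add_distrib, hsum]
  push_cast
  ring

/-- Shifting the cube coordinates by `s · w` (`s` real) shifts the cube point by the real vector
`s · realPoint w`. -/
theorem koe_cubePoint_add_smul (x w : Coord F) (s : ℝ) (y : (F →+* ℝ) → ℝ) :
    cubePoint (x + s • w) y = fun σ ↦ cubePoint x y σ + (s : ℂ) * ((realPoint w σ : ℝ) : ℂ) := by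
  funext σ
  simp only [cubePoint, realPoint, Pi.add_apply, Pi.smul_apply, smul_eq_mul, add_mul,
    Finset.sum_add_distrib]
  push_cast
  rw [Finset.mul_sum]
  simp only [mul_assoc]
  ring

/-- Moving the height by `t · v` is the imaginary shift `z ↦ z + (it) v` of the cube point. -/
theorem koe_cubePoint_height_add (x : Coord F) (y v : (F →+* ℝ) → ℝ) (t : ℝ) :
    cubePoint x (y + t • v) = fun σ ↦ cubePoint x y σ + ((t : ℂ) * I) * ((v σ : ℝ) : ℂ) := by
  funext σ
  simp only [cubePoint, Pi.add_apply, Pi.smul_apply, smul_eq_mul]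
  push_cast
  ring

/-- For `ν` in the dual lattice and `a ∈ 𝓞 F` the phase shift `∑_σ σ(ν) σ(a)` is an integer
(it is `Tr_{F/ℚ}(νa)`, given `∑_σ σ = Tr` for the totally real field). -/
theorem koe_sum_mul_embedding_int
    (htr : ∀ x : F, ∑ σ : F →+* ℝ, σ x = algebraMap ℚ ℝ (Algebra.trace ℚ F x))
    {ν : F} (hν : ∀ a : 𝓞 F, ∃ n : ℤ, Algebra.trace ℚ F (ν * a) = n) (a : 𝓞 F) :
    ∃ n : ℤ, ∑ σ : F →+* ℝ, σ ν * σ (a : F) = n := by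
  obtain ⟨n, hn⟩ := hν a
  refine ⟨n, ?_⟩
  have h := htr (ν * a)
  rw [hn] at h
  simpa [map_mul] using h

/-- **Periodicity of the Fourier integrand** `x ↦ f(x+iy) e^{-2πi S(ν(x+iy))}` under integer shifts of
the cube coordinates, from the `𝓞 F`-periodicity of `f` on `ℍ` and the integrality of `Tr(νa)`. -/
theorem koe_integrand_periodic
    (htr : ∀ x : F, ∑ σ : F →+* ℝ, σ x = algebraMap ℚ ℝ (Algebra.trace ℚ F x))
    (f : Point F → ℂ)
    (hper : ∀ (a : 𝓞 F) (z : Point F), (∀ σ, 0 < (z σ).im) → f (fun σ ↦ z σ + ((σ (a : F) : ℝ) : ℂ)) = f z)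
    {ν : F} (hν : ∀ a : 𝓞 F, ∃ n : ℤ, Algebra.trace ℚ F (ν * a) = n) {y : (F →+* ℝ) → ℝ}
    (hy : ∀ σ, 0 < y σ) (m : Module.Free.ChooseBasisIndex ℤ (𝓞 F) → ℤ) (x : Coord F) :
    f (cubePoint (x + fun i ↦ (m i : ℝ)) y) *
        cexp (-(2 * Real.pi * I * pairing ν (cubePoint (x + fun i ↦ (m i : ℝ)) y))) =
      f (cubePoint x y) * cexp (-(2 * Real.pi * I * pairing ν (cubePoint x y))) := by
  have hz : ∀ σ, 0 < (cubePoint x y σ).im := koe_cubePoint_mem_halfSpace x hy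
  obtain ⟨n, hn⟩ := koe_sum_mul_embedding_int htr hν (∑ i, m i • RingOfIntegers.basis F i)
  have hphase : pairing ν (cubePoint (x + fun i ↦ (m i : ℝ)) y) = pairing ν (cubePoint x y) + n := by
    simp only [pairing, koe_cubePoint_add_intCast, mul_add, Finset.sum_add_distrib]
    congr 1
    exact_mod_cast hn
  rw [hphase, kF_cexp_add_int, koe_cubePoint_add_intCast,
    hper (∑ i, m i • RingOfIntegers.basis F i) (cubePoint x y) hz]

/-- A positive lower bound for finitely many positive reals. -/
theorem koe_exists_pos_le {α : Type} [Fintype α] (y : α → ℝ) (hy : ∀ a, 0 < y a) :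
    ∃ m : ℝ, 0 < m ∧ ∀ a, m ≤ y a := by
  by_cases h : Nonempty α
  · obtain ⟨a₀, -, ha₀⟩ := Finset.exists_min_image Finset.univ y (Finset.univ_nonempty_iff.2 h)
    exact ⟨y a₀, hy a₀, fun a ↦ ha₀ a (Finset.mem_univ a)⟩
  · exact ⟨1, one_pos, fun a ↦ (h ⟨a⟩).elim⟩

/-- A totally real field of degree `≥ 2` has, besides any given real embedding `φ`, another one. -/
theorem koe_exists_realEmbedding_ne (F : Type) [Field F] [NumberField F] [NumberField.IsTotallyReal F]
    (hd : 1 < Module.finrank ℚ F) (φ : F →+* ℝ) : ∃ ψ : F →+* ℝ, ψ ≠ φ := by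
  have hcard : 1 < Fintype.card (F →+* ℂ) := by rwa [NumberField.Embeddings.card F ℂ]
  obtain ⟨φ₁, φ₂, hne⟩ := Fintype.one_lt_card_iff.1 hcard
  have h₁ := NumberField.IsTotallyReal.complexEmbedding_isReal φ₁
  have h₂ := NumberField.IsTotallyReal.complexEmbedding_isReal φ₂
  have hne' : h₁.embedding ≠ h₂.embedding := by
    intro h
    apply hne
    ext x
    have := congrArg (fun e : F →+* ℝ ↦ ((e x : ℝ) : ℂ)) h
    simpa [NumberField.ComplexEmbedding.IsReal.coe_embedding_apply] using this
  by_cases hφ : h₁.embedding = φ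
  · exact ⟨h₂.embedding, fun h ↦ hne' (hφ.trans h.symm)⟩
  · exact ⟨h₁.embedding, hφ⟩

omit [NumberField F] in
/-- The positive cone of heights is convex. -/
theorem koe_convex_heights : Convex ℝ {y : (F →+* ℝ) → ℝ | ∀ σ, 0 < y σ} := by
  have : {y : (F →+* ℝ) → ℝ | ∀ σ, 0 < y σ} = Set.pi Set.univ fun _ ↦ Set.Ioi 0 := by ext; simp
  rw [this]
  exact convex_pi fun _ _ ↦ convex_Ioi 0

/-- **Sup-norm bound for the Fourier coefficient** (T3):
`‖a_ν(y)‖ ≤ (sup_{x} ‖f(x+iy)‖) · e^{2π S(νy)}` for `f` continuous on `ℍ` and `y ≫ 0`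
(the cube has volume `1`; `|e^{-2πi S(ν(x+iy))}| = e^{2π S(νy)}`). -/
theorem koe_norm_fourierCoeffAt_le (f : Point F → ℂ) (hf : ContinuousOn f (halfSpace F)) (ν : F)
    {y : (F →+* ℝ) → ℝ} (hy : ∀ σ, 0 < y σ) :
    ‖fourierCoeffAt f ν y‖ ≤ sSup ((fun x : Coord F ↦ ‖f (cubePoint x y)‖) '' Set.Icc 0 1) *
      Real.exp (2 * Real.pi * ∑ σ : F →+* ℝ, σ ν * y σ) := by
  set M : ℝ := sSup ((fun x : Coord F ↦ ‖f (cubePoint x y)‖) '' Set.Icc 0 1) with hM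
  have hcont : ContinuousOn (fun x : Coord F ↦ f (cubePoint x y)) (Set.Icc 0 1) :=
    hf.comp (koe_continuous_cubePoint y).continuousOn fun x _ ↦ koe_cubePoint_mem_halfSpace x hy
  have hbdd : BddAbove ((fun x : Coord F ↦ ‖f (cubePoint x y)‖) '' Set.Icc 0 1) :=
    (isCompact_Icc.image_of_continuousOn hcont.norm).bddAbove
  have hle : ∀ x ∈ Set.Icc (0 : Coord F) 1, ‖f (cubePoint x y)‖ ≤ M := fun x hx ↦
    le_csSup hbdd ⟨x, hx, rfl⟩
  have hnorm : ∀ x ∈ Set.Icc (0 : Coord F) 1,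
      ‖f (cubePoint x y) * cexp (-(2 * Real.pi * I * pairing ν (cubePoint x y)))‖ ≤
        M * Real.exp (2 * Real.pi * ∑ σ : F →+* ℝ, σ ν * y σ) := by
    intro x hx
    have him : (pairing ν (cubePoint x y)).im = ∑ σ : F →+* ℝ, σ ν * y σ := by
      rw [pairing, Complex.im_sum]
      exact Finset.sum_congr rfl fun σ _ ↦ by simp [cubePoint]
    have hre : (-(2 * Real.pi * I * pairing ν (cubePoint x y))).re =
        2 * Real.pi * ∑ σ : F →+* ℝ, σ ν * y σ := by
      rw [← him]
      simp [Complex.mul_re]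
    rw [norm_mul, Complex.norm_exp, hre]
    exact mul_le_mul_of_nonneg_right (hle x hx) (Real.exp_nonneg _)
  calc ‖fourierCoeffAt f ν y‖
      ≤ (M * Real.exp (2 * Real.pi * ∑ σ : F →+* ℝ, σ ν * y σ)) *
          (volume : Measure (Coord F)).real (Set.Icc 0 1) :=
        norm_setIntegral_le_of_norm_le_const measure_Icc_lt_top hnorm
    _ = M * Real.exp (2 * Real.pi * ∑ σ : F →+* ℝ, σ ν * y σ) := by
        rw [measureReal_def, Real.volume_Icc_pi_toReal (zero_le_one)]
        simp

end Summit.Langlands.Langlands.Theorems.HilbertIntegralOverconvergentIsCongruence
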